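import Summits.BirchSwinnertonDyer.BirchSwinnertonDyer.Theorems.KimAtThreeFineKatoSemiLocalAssembly
import Summits.BirchSwinnertonDyer.BirchSwinnertonDyer.Theorems.KimAtThreeDeepUpperPortSharedOfFineKato
import HarnessLib

/-!
# Crux `KatoKuriharaPortThreeShared` (stmt-BirchSwinnertonDyer-19560) BY NAME from the displayed
# PER-FACTOR defined-Kato package `hKloc` — the composition of this seat's
# `KimAtThreeFineKatoSemiLocalAssembly.fineKato_of_perFactorKatoPackage` (⟨C1⟩ = `stub_fineKato` from
# `hKloc`) with w2-c3's `katoKuriharaPortThreeShared_of_fineKato : ⟨C1⟩ → crux` (p471554)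
# (cell `bsd-addord`, seat kim3 gen 14 = the crux's LEAD; route W2 `KimAtThreeKolyvagin`; `--supports 19560`)

HONEST FRAMING. ONE theorem, no definition, no named fact, no `sorry`; `hKloc` is a DISPLAYED hypothesis,
so this does NOT close 19560; nothing is booked; BSD is not proved.  It records the crux's residual in the
kernel in its sharpest current form: **19560 ⟸ hKloc**, where `hKloc` (per Kato-stratum row: Kato's
`(ι, κ, Λ)` with a `ℚ₃`-component `φ = exp*_ω`; R-κ; the `ℚ₃`-level print facts [BK90] 3.8/3.11 + Tate
duality for `φ`; PER FACTOR `w ∣ 3` of `ℚ(ζ_m)` the log-lattice `Λ₀ʷ ⊆ 𝒪_w`, the `exp*`-lattice `Mʷ` with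
`Tr(Mʷ·Λ₀ʷ) ⊆ ℤ₃`, one factor with a unit-trace element, and the per-factor COMPAT clause; Kato's
`ZetaBody` family — see `KimAtThreeFineKatoSemiLocalAssembly`'s docstring) contains NO rider predicate, NO
finite-level functional and NO tensor-algebra statement: the semi-local bookkeeping
(`KimAtThreeFineKatoSemiLocalTransport`), `Λfin`, rider (i)/(ii) and SAT₀ are kernel theorems.  Compared
with kim3 g13's `katoKuriharaPortThreeShared_of_definedKatoPackage` (p491642, package `hK` =
registered `stub_definedKatoPackage`): `hK`'s one semi-local clause is replaced by statements inside single
completions `L_w`, which is the currency of the seats that supply them (w2-kport, w2-acc5, w2-acc4).  This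
file lives in the route file's import cone by necessity (it concludes the crux by name).
-/

noncomputable section

-- the cell's Theorems namespace `Summit.BirchSwinnertonDyer.BirchSwinnertonDyer.…` repeats the summit name by design (D-0017)
set_option linter.dupNamespace false

open scoped Classical NumberField TensorProduct ContRepresentation
open Field NumberField IsDedekindDomain
open WeierstrassCurve Literature.NumberTheory.EllipticCurves Literature.NumberTheory.GaloisRepresentations
  Literature.NumberTheory.GaloisRepresentations.DiscreteGaloisModule Literature.NumberTheory.GaloisCohomology
open Literature.NumberTheory.EllipticCurves.ModularForms Literature.NumberTheory.EllipticCurves.Rank1Residual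
open Literature.NumberTheory.EllipticCurves.Kato2004 Literature.NumberTheory.EllipticCurves.Kato2004.EulerSystemValues
open Summit.BirchSwinnertonDyer.Rank1Residual.GaloisImage
open Summit.BirchSwinnertonDyer.Rank1Residual.Additive.LocalLog
open Summit.BirchSwinnertonDyer.BirchSwinnertonDyer.Theorems

namespace Summit.BirchSwinnertonDyer.BirchSwinnertonDyer.Theorems.KimAtThreeFineKatoSemiLocalAssemblyCrux

/-- **Crux `KatoKuriharaPortThreeShared` BY NAME from the displayed PER-FACTOR defined-Kato package
`hKloc`** (`KimAtThreeFineKatoSemiLocalAssembly.fineKato_of_perFactorKatoPackage`, then w2-c3's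
`katoKuriharaPortThreeShared_of_fineKato`).  `hKloc` displayed — NOT a closing theorem.
[cite: Kato2004Asterisque, (8.1.3) (p. 180), Prop. 8.12 (p. 186), §9.4 and Thm. 9.7 (pp. 188–189), Thm. 6.6 (1) (p. 163), Ex. 13.3 (pp. 224–225)]
[cite: BlochKato1990, §3 (Prop. 3.8, Ex. 3.11)] [cite: Kim2022StructureSelmer, §3.3–§3.4.1 and Thm. 3.13]
[cite: MazurRubin2004, Thm. 3.2.4 and App. A Remark A.5] [cite: CasselsFrohlichANT1967, Ch. II §10 Theorem (10.2)] -/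
theorem katoKuriharaPortThreeShared_of_perFactorKatoPackage
    (hKloc : ∀ (W : WeierstrassCurve ℚ) [W.IsElliptic] [W.IsGloballyMinimal]
      [ContinuousSMul ℤ_[3] (W.tateModule 3)] [Module.Free ℤ_[3] (W.tateModule 3)]
      [Module.Finite ℤ_[3] (W.tateModule 3)],
      (∀ m : ℕ, W.HasSurjectiveModNGaloisRep (3 ^ m : ℕ)) →
      (haveI : Fact (Nat.Prime 3) := ⟨Nat.prime_three⟩; Addv W 3) →
      ¬ 3 ∣ (W.baseChange ℚ_[3]).localTamagawaNumber ℤ_[3] →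
      Nat.card {Q : (W.baseChange ℚ_[3]).toAffine.Point // (3 : ℕ) • Q = 0} = 1 →
      ∀ (v₃ : HeightOneSpectrum (𝓞 ℚ)), ((3 : ℕ) : 𝓞 ℚ) ∈ v₃.asIdeal →
      ∀ {N : ℕ} [NeZero N] (P : ModularParametrizationData W N), N = W.conductorNorm ℤ →
        (∀ z ∈ P.L.lattice, ∃ w ∈ periodLattice P.f, z = P.c * w) →
        ¬ (3 : ℤ) ∣ P.maninConstant →
        ∃ (ι : (n : ℕ) → (CyclotomicField n ℚ →+* ℂ)) (κK : ℝ)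
          (Λ : ∀ (k' : ℕ) (r : Finset (HeightOneSpectrum (𝓞 ℚ))),
            H1 (tateRep W 3) (cycSubgroup 3 k' r) →ₗ[ℤ_[3]]
              ℚ_[3] ⊗[ℚ] CyclotomicField (cycLevel 3 k' r) ℚ)
          (φ : (tateLocalRep W 3 (Sum.inr v₃)).cohomology 1 →+ ℚ_[3]),
          κK ≠ 0 ∧ (∃ u : ℚ, (u : ℝ) = κK ∧ padicValRat 3 u = 0) ∧
          (∀ y, φ y = 0 ↔ ∀ j : ℕ, tateLocalMap W 3 j (Sum.inr v₃) y ∈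
            W.kummerSelmerStructure (((3 : ℕ) : ℤ) ^ j * ((3 : ℕ) : ℤ)) (Sum.inr v₃)) ∧
          (∀ a : ℚ_[3], (∃ y, φ y = a) ↔
            ∀ Q : (W.baseChange ℚ_[3]).toAffine.Point, ‖a * padicLog (W.baseChange ℚ_[3]) Q‖ ≤ 1) ∧
          (∀ (j : ℕ) (r : Finset (HeightOneSpectrum (𝓞 ℚ)))
            (Ψ : ℚ_[3] ⊗[ℚ] CyclotomicField (cycLevel 3 0 r) ℚ ≃ₐ[ℚ]
              (Π w : ((Rat.HeightOneSpectrum.primesEquiv (R := 𝓞 ℚ)).symm ⟨3, Fact.out⟩).Extension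
                (𝓞 (CyclotomicField (cycLevel 3 0 r) ℚ)), w.1.adicCompletion (CyclotomicField (cycLevel 3 0 r) ℚ))),
            (∀ (s : ℚ_[3]) (x : CyclotomicField (cycLevel 3 0 r) ℚ)
              (w : ((Rat.HeightOneSpectrum.primesEquiv (R := 𝓞 ℚ)).symm ⟨3, Fact.out⟩).Extension
                (𝓞 (CyclotomicField (cycLevel 3 0 r) ℚ))),
              Ψ (s ⊗ₜ[ℚ] x) w =
                algebraMap (CyclotomicField (cycLevel 3 0 r) ℚ) (w.1.adicCompletion (CyclotomicField (cycLevel 3 0 r) ℚ)) x *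
                algebraMap (((Rat.HeightOneSpectrum.primesEquiv (R := 𝓞 ℚ)).symm ⟨3, Fact.out⟩).adicCompletion ℚ)
                  (w.1.adicCompletion (CyclotomicField (cycLevel 3 0 r) ℚ)) (Padic.adicCompletionEquiv (𝓞 ℚ) ⟨3, Fact.out⟩ s)) →
            ∃ (Λ₀' M' : ∀ w : ((Rat.HeightOneSpectrum.primesEquiv (R := 𝓞 ℚ)).symm ⟨3, Fact.out⟩).Extension
                (𝓞 (CyclotomicField (cycLevel 3 0 r) ℚ)), Set (w.1.adicCompletion (CyclotomicField (cycLevel 3 0 r) ℚ))),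
              (∀ w, Λ₀' w ⊆ w.1.adicCompletionIntegers (CyclotomicField (cycLevel 3 0 r) ℚ)) ∧
              (∀ w, (0 : w.1.adicCompletion (CyclotomicField (cycLevel 3 0 r) ℚ)) ∈ Λ₀' w) ∧
              (∃ w₀, ∃ ℓ₀ ∈ Λ₀' w₀, ‖(Padic.adicCompletionEquiv (𝓞 ℚ) ⟨3, Fact.out⟩).symm
                (Algebra.trace (((Rat.HeightOneSpectrum.primesEquiv (R := 𝓞 ℚ)).symm ⟨3, Fact.out⟩).adicCompletion ℚ)
                  (w₀.1.adicCompletion (CyclotomicField (cycLevel 3 0 r) ℚ)) ℓ₀)‖ = 1) ∧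
              (∀ w, ∀ μ ∈ M' w, ∀ ℓ ∈ Λ₀' w, ‖(Padic.adicCompletionEquiv (𝓞 ℚ) ⟨3, Fact.out⟩).symm
                (Algebra.trace (((Rat.HeightOneSpectrum.primesEquiv (R := 𝓞 ℚ)).symm ⟨3, Fact.out⟩).adicCompletion ℚ)
                  (w.1.adicCompletion (CyclotomicField (cycLevel 3 0 r) ℚ)) (μ * ℓ))‖ ≤ 1) ∧
              ∀ (Ψ' : H1 (tateRep W 3) (cycSubgroup 3 0 r) →+
                  continuousCohomology 1 (subgroupRep
                    (W.torsionGaloisModule (((3 : ℕ) : ℤ) ^ j * ((3 : ℕ) : ℤ))).toTopRep (cycSubgroup 3 0 r))),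
                (∀ (φ' : contOneCocycles (subgroupRep (tateRep W 3).toTopRep (cycSubgroup 3 0 r)))
                    (ψ : contOneCocycles (subgroupRep
                      (W.torsionGaloisModule (((3 : ℕ) : ℤ) ^ j * ((3 : ℕ) : ℤ))).toTopRep (cycSubgroup 3 0 r))),
                    (∀ g, ((ψ.1 g : geomTorsion W (((3 : ℕ) : ℤ) ^ j * ((3 : ℕ) : ℤ))) : geomPoints W) =
                      TateModule.proj 3 (j + 1) (φ'.1 g)) →
                    Ψ' (oneCocycleClass _ φ') = oneCocycleClass _ ψ) →
                ∀ (y : H1 (tateRep W 3) (cycSubgroup 3 0 r))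
                  (κ₀ : galoisCohomology (W.torsionGaloisModule (((3 : ℕ) : ℤ) ^ j * ((3 : ℕ) : ℤ))) 1)
                  (h : (tateLocalRep W 3 (Sum.inr v₃)).cohomology 1),
                  resSubgroup (W.torsionGaloisModule (((3 : ℕ) : ℤ) ^ j * ((3 : ℕ) : ℤ))).toTopRep
                      (cycSubgroup 3 0 r) 1 κ₀ = Ψ' y →
                  galoisCohomology.localization (W.torsionGaloisModule (((3 : ℕ) : ℤ) ^ j * ((3 : ℕ) : ℤ)))
                      (Sum.inr v₃) 1 κ₀ = tateLocalMap W 3 j (Sum.inr v₃) h →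
                  ∀ w, ∃ μ ∈ M' w,
                    Ψ ((φ h ⊗ₜ[ℚ] (1 : CyclotomicField (cycLevel 3 0 r) ℚ)) -
                        (((3 : ℕ) : ℤ_[3]) ^ (0 : ℕ)) • Λ 0 r y) w =
                      (((3 : ℕ) : w.1.adicCompletion (CyclotomicField (cycLevel 3 0 r) ℚ)) ^ (j + 1)) * μ) ∧
          ∀ (c d a : ℤ) (A : ℕ), 0 < A → Int.gcd c (6 * 3 * A) = 1 → Int.gcd d (6 * 3 * N) = 1 →
            ∃ (z : ∀ (k' : ℕ) (r : (cyclotomicLevelsRat 3 (badPlaces c d A N)).Ideals),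
                  H1 (tateRep W 3) ((cyclotomicLevelsRat 3 (badPlaces c d A N)).level k' r.1))
              (x : ∀ (k' : ℕ) (r : (cyclotomicLevelsRat 3 (badPlaces c d A N)).Ideals),
                  CyclotomicField (cycLevel 3 k' r.1) ℚ),
              ZetaBody W 3 P.f ι κK Λ c d a A z x) :
    Summit.BirchSwinnertonDyer.BirchSwinnertonDyer.Theses.KimAtThreeKolyvagin.KatoKuriharaPortThreeShared :=
  KimAtThreeDeepUpperPortSharedOfFineKato.katoKuriharaPortThreeShared_of_fineKato
    (KimAtThreeFineKatoSemiLocalAssembly.fineKato_of_perFactorKatoPackage hKloc)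

end Summit.BirchSwinnertonDyer.BirchSwinnertonDyer.Theorems.KimAtThreeFineKatoSemiLocalAssemblyCrux

end
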